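import Literature.ModelTheory.ExponentialFields.SemialgebraicC1TriangulationLifting
import HarnessLib

/-!
# Rich cut families (capsule refinement subordinate to an open cover, I: the calculus of cuts)

Topic `Literature/ModelTheory/ExponentialFields` — block B2a of the proof of the `C¹`-triangulation
theorem for compact semialgebraic sets
(`Literature.ModelTheory.ExponentialFields.OhmotoShiota2017_c1Triangulation`, statement of
[OhmotoShiota2017, Thm. 1.1]) along the proof of [Pawlucki2024], specialized to `p = 1`.

Pawłucki's Proposition 2.5 refines a capsule `[a, b]` over `D` into finitely many capsules each of
whose interiors lies in one member of a given finite open cover `𝒱 = (V_j)` of the open capsule.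
We formalize it (blocks B2a–B2c) in the following *rich cut* form, which is what Lemma 5.1 consumes
after sorting (block B5, `CRDerivHyp`): a finite family `𝒞` of continuous semialgebraic functions
on `D` is **valid at `x`** (`RCValid`) when every complementary interval of the finite set of cut
values `{a x, b x} ∪ {c x : c ∈ 𝒞, a x < c x < b x}` in the fibre `(a x, b x)` lies in a single
`V_j`.  The point of the reformulation is the monotonicity `RCValid.mono`: *extra cuts are
harmless*, so the pairwise-disjointness bookkeeping of [Pawlucki2024, Prop. 2.1, Cor. 2.4] is not
needed, and cut families built for different purposes are simply united.

This file: the definitions, monotonicity, splitting, the germ lemma (every fibre has an initial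
and a final segment inside one `V_j`, by o-minimality of the fibres), and the passage from a valid
family to a laminar refinement by order statistics [Pawlucki2024, Remark 2.2 / Cor. 2.4].

No named facts are introduced (D-0026).

## References

* [Pawlucki2024] W. Pawłucki, *Strict `C^p`-triangulations — a new approach to
  desingularization*, J. Eur. Math. Soc. 26 (2024), 3863–3909, §2 (Prop. 2.1, Remarks 2.2–2.3,
  Cor. 2.4, Prop. 2.5).
* [Dries1998] L. van den Dries, *Tame topology and o-minimal structures*, Ch. 3 (o-minimality of
  fibres).
* [OhmotoShiota2017] T. Ohmoto, M. Shiota, *`C¹`-triangulations of semialgebraic sets*,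
  J. Topology 10 (2017), Thm. 1.1 (statement only).
-/

noncomputable section

open Set Filter Finset
open _root_.Topology

namespace Literature.ModelTheory.ExponentialFields

open Literature.NumberTheory.Transcendental (IsSemialgebraicFunOn IsSemialgebraicMapOn
  isSemialgebraicFunOn_iff)

section RichCuts

variable {m q : ℕ}

/-! ### Cut values, good intervals, validity -/

/-- The cut values of the family `𝒞` in the fibre over `x`: the two ends `a x`, `b x` and the
values `c x` of members of `𝒞` lying strictly inside `(a x, b x)`. [cite: Pawlucki2024, Prop. 2.5] -/
def rcCutVals (a b : (Fin m → ℝ) → ℝ) (𝒞 : Finset ((Fin m → ℝ) → ℝ)) (x : Fin m → ℝ) : Set ℝ :=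
  {w | w = a x ∨ w = b x ∨ ∃ c ∈ 𝒞, w = c x ∧ a x < c x ∧ c x < b x}

/-- A fibre interval `{x} × (u, v)` is *good* for the cover `V` when it lies in a single `V j`.
[cite: Pawlucki2024, Prop. 2.5] -/
def RCGood (V : Fin q → Set (Fin (m + 1) → ℝ)) (x : Fin m → ℝ) (u v : ℝ) : Prop :=
  ∃ j, ∀ t ∈ Ioo u v, (Fin.snoc x t : Fin (m + 1) → ℝ) ∈ V j

/-- **Validity of a cut family at `x`**: every complementary interval of the cut values in the
fibre `(a x, b x)` is good. [cite: Pawlucki2024, Prop. 2.5] -/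
def RCValid (a b : (Fin m → ℝ) → ℝ) (V : Fin q → Set (Fin (m + 1) → ℝ))
    (𝒞 : Finset ((Fin m → ℝ) → ℝ)) (x : Fin m → ℝ) : Prop :=
  a x ≤ b x → ∀ u ∈ rcCutVals a b 𝒞 x, ∀ v ∈ rcCutVals a b 𝒞 x, u < v →
    (∀ w ∈ rcCutVals a b 𝒞 x, w ≤ u ∨ v ≤ w) → RCGood V x u v

variable {a b : (Fin m → ℝ) → ℝ} {V : Fin q → Set (Fin (m + 1) → ℝ)}
  {𝒞 𝒞' : Finset ((Fin m → ℝ) → ℝ)} {x : Fin m → ℝ}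

/-- The bottom end is a cut value. [cite: Pawlucki2024, Prop. 2.5] -/
theorem left_mem_rcCutVals : a x ∈ rcCutVals a b 𝒞 x := Or.inl rfl

/-- The top end is a cut value. [cite: Pawlucki2024, Prop. 2.5] -/
theorem right_mem_rcCutVals : b x ∈ rcCutVals a b 𝒞 x := Or.inr (Or.inl rfl)

/-- An inner value of a member is a cut value. [cite: Pawlucki2024, Prop. 2.5] -/
theorem mem_rcCutVals_of_mem {c : (Fin m → ℝ) → ℝ} (hc : c ∈ 𝒞) (h1 : a x < c x) (h2 : c x < b x) :
    c x ∈ rcCutVals a b 𝒞 x := Or.inr (Or.inr ⟨c, hc, rfl, h1, h2⟩)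

/-- Cut values lie in `[a x, b x]` (when `a x ≤ b x`). [cite: Pawlucki2024, Prop. 2.5] -/
theorem mem_Icc_of_mem_rcCutVals (hab : a x ≤ b x) {w : ℝ} (hw : w ∈ rcCutVals a b 𝒞 x) :
    w ∈ Icc (a x) (b x) := by
  rcases hw with rfl | rfl | ⟨c, -, rfl, h1, h2⟩
  · exact ⟨le_rfl, hab⟩
  · exact ⟨hab, le_rfl⟩
  · exact ⟨h1.le, h2.le⟩

/-- The set of cut values is finite. [cite: Pawlucki2024, Prop. 2.5] -/
theorem rcCutVals_finite (a b : (Fin m → ℝ) → ℝ) (𝒞 : Finset ((Fin m → ℝ) → ℝ)) (x : Fin m → ℝ) :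
    (rcCutVals a b 𝒞 x).Finite := by
  classical
  have h : rcCutVals a b 𝒞 x ⊆ ↑(insert (a x) (insert (b x) (𝒞.image fun c => c x))) := by
    intro w hw
    rcases hw with rfl | rfl | ⟨c, hc, rfl, -, -⟩
    · simp
    · simp
    · simp only [Finset.coe_insert, Finset.coe_image, Set.mem_insert_iff, Set.mem_image,
        Finset.mem_coe]
      exact Or.inr (Or.inr ⟨c, hc, rfl⟩)
  exact (Finset.finite_toSet _).subset h

/-- Cut values are monotone in the family. [cite: Pawlucki2024, Prop. 2.5] -/
theorem rcCutVals_mono (h : 𝒞 ⊆ 𝒞') : rcCutVals a b 𝒞 x ⊆ rcCutVals a b 𝒞' x := by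
  rintro w (rfl | rfl | ⟨c, hc, rfl, h1, h2⟩)
  · exact left_mem_rcCutVals
  · exact right_mem_rcCutVals
  · exact mem_rcCutVals_of_mem (h hc) h1 h2

/-- Sub-intervals of good intervals are good. [cite: Pawlucki2024, Prop. 2.5] -/
theorem RCGood.mono {u v u' v' : ℝ} (h : RCGood V x u v) (hu : u ≤ u') (hv : v' ≤ v) :
    RCGood V x u' v' := by
  obtain ⟨j, hj⟩ := h
  exact ⟨j, fun t ht => hj t ⟨hu.trans_lt ht.1, ht.2.trans_le hv⟩⟩

/-- Empty intervals are good (given the cover is indexed by a nonempty type). [folklore] -/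
theorem rcGood_of_le [NeZero q] {u v : ℝ} (h : v ≤ u) : RCGood V x u v :=
  ⟨0, fun _ ht => absurd (ht.1.trans ht.2) (not_lt.2 h)⟩

/-- **Extra cuts are harmless**: validity is monotone in the cut family.
[cite: Pawlucki2024, Prop. 2.5 (proof, Part II)] -/
theorem RCValid.mono (hV : RCValid a b V 𝒞 x) (h : 𝒞 ⊆ 𝒞') : RCValid a b V 𝒞' x := by
  intro hab u' hu' v' hv' hlt hcons
  have hfin := rcCutVals_finite a b 𝒞 x
  -- the largest old cut value `≤ u'` and the smallest old cut value `≥ v'`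
  set L : Set ℝ := {w ∈ rcCutVals a b 𝒞 x | w ≤ u'} with hL
  set R : Set ℝ := {w ∈ rcCutVals a b 𝒞 x | v' ≤ w} with hR
  have hLfin : L.Finite := hfin.subset (sep_subset _ _)
  have hRfin : R.Finite := hfin.subset (sep_subset _ _)
  have hu'I := mem_Icc_of_mem_rcCutVals hab hu'
  have hv'I := mem_Icc_of_mem_rcCutVals hab hv'
  have hLne : L.Nonempty := ⟨a x, left_mem_rcCutVals, hu'I.1⟩
  have hRne : R.Nonempty := ⟨b x, right_mem_rcCutVals, hv'I.2⟩
  obtain ⟨u, huL, humax⟩ := hLfin.exists_maximal hLne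
  obtain ⟨v, hvR, hvmin⟩ := hRfin.exists_minimal hRne
  have huv : u < v := lt_of_le_of_lt huL.2 (hlt.trans_le hvR.2)
  have hcons' : ∀ w ∈ rcCutVals a b 𝒞 x, w ≤ u ∨ v ≤ w := by
    intro w hw
    rcases hcons w (rcCutVals_mono h hw) with hwu | hwv
    · left
      by_contra hlt'
      exact hlt' (humax ⟨hw, hwu⟩ (not_le.1 hlt').le)
    · right
      by_contra hlt'
      exact hlt' (hvmin ⟨hw, hwv⟩ (not_le.1 hlt').le)
  exact (hV hab u huL.1 v hvR.1 huv hcons').mono huL.2 hvR.2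

/-- Degenerate fibres are valid. [cite: Pawlucki2024, Prop. 2.5] -/
theorem rcValid_of_le (h : b x ≤ a x) : RCValid a b V 𝒞 x := by
  intro hab u hu v hv hlt _
  have heq : a x = b x := le_antisymm hab h
  have hu' : u = a x := by
    rcases hu with rfl | rfl | ⟨c, -, rfl, h1, h2⟩
    · rfl
    · exact heq.symm
    · exact absurd (h1.trans h2) (by rw [heq]; exact lt_irrefl _)
  have hv' : v = a x := by
    rcases hv with rfl | rfl | ⟨c, -, rfl, h1, h2⟩
    · rfl
    · exact heq.symm
    · exact absurd (h1.trans h2) (by rw [heq]; exact lt_irrefl _)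
  rw [hu', hv'] at hlt
  exact absurd hlt (lt_irrefl _)

/-- **Validity from a sufficient condition on arbitrary sub-intervals free of inner cuts**: if every
open interval `(u, v) ⊆ (a x, b x)` containing no cut value is good, the family is valid.
[cite: Pawlucki2024, Prop. 2.5] -/
theorem rcValid_of_forall
    (h : ∀ u v, a x ≤ u → v ≤ b x → u < v → (∀ w ∈ rcCutVals a b 𝒞 x, w ≤ u ∨ v ≤ w) → RCGood V x u v) :
    RCValid a b V 𝒞 x := fun hab u hu v hv hlt hcons =>
  h u v (mem_Icc_of_mem_rcCutVals hab hu).1 (mem_Icc_of_mem_rcCutVals hab hv).2 hlt hcons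

/-- The whole fibre good ⇒ every family is valid there. [cite: Pawlucki2024, Prop. 2.5] -/
theorem rcValid_of_rcGood (h : RCGood V x (a x) (b x)) : RCValid a b V 𝒞 x :=
  rcValid_of_forall fun _ _ hu hv _ _ => h.mono hu hv

/-- **Splitting**: validity of the truncated fibres `(a x, h x)` and `(h x, b x)` (for families
contained in `𝒞`) gives validity of `𝒞` on `(a x, b x)` once `h ∈ 𝒞`.
[cite: Pawlucki2024, Prop. 2.5 (proof, Part II)] -/
theorem RCValid.of_split {h : (Fin m → ℝ) → ℝ} {𝒞₁ 𝒞₂ : Finset ((Fin m → ℝ) → ℝ)}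
    (hah : a x ≤ h x) (hhb : h x ≤ b x) (h₁ : RCValid a h V 𝒞₁ x) (h₂ : RCValid h b V 𝒞₂ x)
    (hs₁ : 𝒞₁ ⊆ 𝒞) (hs₂ : 𝒞₂ ⊆ 𝒞) (hmem : h ∈ 𝒞) : RCValid a b V 𝒞 x := by
  refine rcValid_of_forall fun u v hu hv hlt hcons => ?_
  -- `h x` is not strictly inside `(u, v)`
  have hhx : h x ≤ u ∨ v ≤ h x := by
    rcases eq_or_lt_of_le hah with heq | hlt₁
    · exact Or.inl (heq ▸ hu)
    rcases eq_or_lt_of_le hhb with heq | hlt₂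
    · exact Or.inr (heq ▸ hv)
    exact hcons _ (mem_rcCutVals_of_mem hmem hlt₁ hlt₂)
  rcases hhx with hle | hle
  · -- the interval lies in `(h x, b x)`: use `h₂`
    have h₂' := h₂.mono hs₂
    -- cut values of `𝒞` w.r.t. `(h, b)` avoid `(u, v)`
    refine rcValid_iff_forall_aux h₂' hhb hle hv hlt fun w hw => ?_
    rcases hw with rfl | rfl | ⟨c, hc, rfl, h1, h2⟩
    · exact Or.inl hle
    · exact Or.inr hv
    · exact hcons _ (mem_rcCutVals_of_mem hc (lt_of_le_of_lt hah h1) h2)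
  · have h₁' := h₁.mono hs₁
    refine rcValid_iff_forall_aux h₁' hah hu hle hlt fun w hw => ?_
    rcases hw with rfl | rfl | ⟨c, hc, rfl, h1, h2⟩
    · exact Or.inl hu
    · exact Or.inr hle
    · exact hcons _ (mem_rcCutVals_of_mem hc h1 (lt_of_lt_of_le h2 hhb))
where
  /-- validity applied to an arbitrary inner-cut-free interval -/
  rcValid_iff_forall_aux {a' b' : (Fin m → ℝ) → ℝ} {𝒟 : Finset ((Fin m → ℝ) → ℝ)} {u v : ℝ}
      (hV : RCValid a' b' V 𝒟 x) (hab : a' x ≤ b' x) (hu : a' x ≤ u) (hv : v ≤ b' x) (hlt : u < v)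
      (hcons : ∀ w ∈ rcCutVals a' b' 𝒟 x, w ≤ u ∨ v ≤ w) : RCGood V x u v := by
    have hfin := rcCutVals_finite a' b' 𝒟 x
    set L : Set ℝ := {w ∈ rcCutVals a' b' 𝒟 x | w ≤ u}
    set R : Set ℝ := {w ∈ rcCutVals a' b' 𝒟 x | v ≤ w}
    obtain ⟨u₀, hu₀, humax⟩ := (hfin.subset (sep_subset _ _)).exists_maximal
      (⟨a' x, left_mem_rcCutVals, hu⟩ : L.Nonempty)
    obtain ⟨v₀, hv₀, hvmin⟩ := (hfin.subset (sep_subset _ _)).exists_minimal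
      (⟨b' x, right_mem_rcCutVals, hv⟩ : R.Nonempty)
    have hlt₀ : u₀ < v₀ := lt_of_le_of_lt hu₀.2 (hlt.trans_le hv₀.2)
    refine (hV hab u₀ hu₀.1 v₀ hv₀.1 hlt₀ fun w hw => ?_).mono hu₀.2 hv₀.2
    rcases hcons w hw with hwu | hwv
    · left
      by_contra hlt'
      exact hlt' (humax ⟨hw, hwu⟩ (not_le.1 hlt').le)
    · right
      by_contra hlt'
      exact hlt' (hvmin ⟨hw, hwv⟩ (not_le.1 hlt').le)

/-- **Validity applied to an arbitrary interval free of inner cut values.**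
[cite: Pawlucki2024, Prop. 2.5] -/
theorem RCValid.rcGood (hV : RCValid a b V 𝒞 x) {u v : ℝ} (hu : a x ≤ u) (hv : v ≤ b x)
    (hlt : u < v) (hcons : ∀ w ∈ rcCutVals a b 𝒞 x, w ≤ u ∨ v ≤ w) : RCGood V x u v :=
  RCValid.of_split.rcValid_iff_forall_aux hV (hu.trans (hlt.le.trans hv)) hu hv hlt hcons

/-- Validity transfers to any SMALLER fibre `(a' x, b' x) ⊆ (a x, b x)` (same cuts).
[cite: Pawlucki2024, Prop. 2.5] -/
theorem RCValid.restrict {a' b' : (Fin m → ℝ) → ℝ} (hV : RCValid a b V 𝒞 x)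
    (ha : a x ≤ a' x) (hb : b' x ≤ b x) : RCValid a' b' V 𝒞 x := by
  refine rcValid_of_forall fun u v hu hv hlt hcons => ?_
  refine hV.rcGood (ha.trans hu) (hv.trans hb) hlt fun w hw => ?_
  rcases hw with rfl | rfl | ⟨c, hc, rfl, h1, h2⟩
  · exact Or.inl (ha.trans hu)
  · exact Or.inr (hv.trans hb)
  · -- `c x` inside `(a x, b x)`: compare with `a' x`, `b' x`
    rcases lt_or_ge (c x) (a' x) with hca | hca
    · exact Or.inl (hca.le.trans hu)
    rcases lt_or_ge (b' x) (c x) with hcb | hcb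
    · exact Or.inr (hv.trans hcb.le)
    rcases eq_or_lt_of_le hca with heq | hlt₁
    · exact Or.inl (heq ▸ hu)
    rcases eq_or_lt_of_le hcb with heq | hlt₂
    · exact Or.inr (heq ▸ hv)
    exact hcons _ (mem_rcCutVals_of_mem hc hlt₁ hlt₂)

/-! ### Germs: initial and final fibre segments lie in one member of the cover -/

/-- **Bottom germ**: if the fibre `(a x, b x)` is covered by the semialgebraic sets `V j`, some
`V j` contains an initial segment `(a x, e]`, `a x < e < b x` (o-minimality of the fibres).
[cite: Pawlucki2024, Prop. 2.5 (proof, Part I)] -/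
theorem exists_Ioc_subset_of_cover (hV : ∀ j, IsSemialgebraic ℝ (V j)) (hab : a x < b x)
    (hcov : ∀ t ∈ Ioo (a x) (b x), ∃ j, (Fin.snoc x t : Fin (m + 1) → ℝ) ∈ V j) :
    ∃ j, ∃ e ∈ Ioo (a x) (b x), ∀ t ∈ Ioc (a x) e, (Fin.snoc x t : Fin (m + 1) → ℝ) ∈ V j := by
  classical
  by_contra hne
  push Not at hne
  -- every `V j` misses a right-neighbourhood of `a x`
  have hmiss : ∀ j, ∀ᶠ t in 𝓝[>] (a x), (Fin.snoc x t : Fin (m + 1) → ℝ) ∉ V j := by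
    intro j
    rcases Literature.NumberTheory.Transcendental.SemialgebraicMonotonicity.eventually_nhdsGT_mem_or
      (A := {t : ℝ | (Fin.snoc x t : Fin (m + 1) → ℝ) ∈ V j})
      (isSemialgebraic_fibre_snoc (hV j) x) (a x) with h | h
    · exfalso
      obtain ⟨e, he, hsub⟩ := mem_nhdsGT_iff_exists_Ioo_subset.mp h
      have hae : a x < e := he
      set e' := min ((a x + e) / 2) ((a x + b x) / 2) with he'
      have he'1 : a x < e' := lt_min (by linarith) (by linarith)
      have he'2 : e' < b x := (min_le_right _ _).trans_lt (by linarith)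
      have he'3 : e' < e := (min_le_left _ _).trans_lt (by linarith)
      obtain ⟨t, ht, hnot⟩ := hne j e' ⟨he'1, he'2⟩
      exact hnot (hsub ⟨ht.1, ht.2.trans_lt he'3⟩)
    · exact h
  have hall : ∀ᶠ t in 𝓝[>] (a x), ∀ j, (Fin.snoc x t : Fin (m + 1) → ℝ) ∉ V j :=
    eventually_all.2 hmiss
  have hIoo : ∀ᶠ t in 𝓝[>] (a x), t ∈ Ioo (a x) (b x) := Ioo_mem_nhdsGT hab
  obtain ⟨t, ht, htI⟩ := (hall.and hIoo).exists
  obtain ⟨j, hj⟩ := hcov t htI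
  exact ht j hj

/-- **Top germ**: symmetric statement at the top end. [cite: Pawlucki2024, Prop. 2.5 (proof, Part II)] -/
theorem exists_Ico_subset_of_cover (hV : ∀ j, IsSemialgebraic ℝ (V j)) (hab : a x < b x)
    (hcov : ∀ t ∈ Ioo (a x) (b x), ∃ j, (Fin.snoc x t : Fin (m + 1) → ℝ) ∈ V j) :
    ∃ j, ∃ e ∈ Ioo (a x) (b x), ∀ t ∈ Ico e (b x), (Fin.snoc x t : Fin (m + 1) → ℝ) ∈ V j := by
  classical
  by_contra hne
  push Not at hne
  have hmiss : ∀ j, ∀ᶠ t in 𝓝[<] (b x), (Fin.snoc x t : Fin (m + 1) → ℝ) ∉ V j := by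
    intro j
    rcases Literature.NumberTheory.Transcendental.SemialgebraicMonotonicity.eventually_nhdsLT_mem_or
      (A := {t : ℝ | (Fin.snoc x t : Fin (m + 1) → ℝ) ∈ V j})
      (isSemialgebraic_fibre_snoc (hV j) x) (b x) with h | h
    · exfalso
      obtain ⟨e, he, hsub⟩ := mem_nhdsLT_iff_exists_Ioo_subset.mp h
      have heb : e < b x := he
      set e' := max ((e + b x) / 2) ((a x + b x) / 2) with he'
      have he'1 : a x < e' := lt_of_lt_of_le (by linarith) (le_max_right _ _)
      have he'2 : e' < b x := max_lt (by linarith) (by linarith)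
      have he'3 : e < e' := lt_of_lt_of_le (by linarith) (le_max_left _ _)
      obtain ⟨t, ht, hnot⟩ := hne j e' ⟨he'1, he'2⟩
      exact hnot (hsub ⟨he'3.trans_le ht.1, ht.2⟩)
    · exact h
  have hall : ∀ᶠ t in 𝓝[<] (b x), ∀ j, (Fin.snoc x t : Fin (m + 1) → ℝ) ∉ V j :=
    eventually_all.2 hmiss
  have hIoo : ∀ᶠ t in 𝓝[<] (b x), t ∈ Ioo (a x) (b x) := Ioo_mem_nhdsLT hab
  obtain ⟨t, ht, htI⟩ := (hall.and hIoo).exists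
  obtain ⟨j, hj⟩ := hcov t htI
  exact ht j hj

/-! ### From a valid family to a laminar refinement (order statistics) -/

/-- Clamp of a cut function into `[a, b]`. [cite: Pawlucki2024, Remark 2.2] -/
def rcClampFun (a b c : (Fin m → ℝ) → ℝ) (x : Fin m → ℝ) : ℝ := max (a x) (min (c x) (b x))

/-- The family to sort: `a`, `b` and the clamped cuts, indexed by `Fin (N + 2)`.
[cite: Pawlucki2024, Remark 2.2] -/
def rcFamily (a b : (Fin m → ℝ) → ℝ) {N : ℕ} (c : Fin N → (Fin m → ℝ) → ℝ) :
    Fin (N + 2) → (Fin m → ℝ) → ℝ :=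
  Fin.cons a (Fin.cons b fun i => rcClampFun a b (c i))

/-- **The laminar refinement**: the `k`-th order statistic of the family (junk `b` beyond the range).
[cite: Pawlucki2024, Remark 2.2, Cor. 2.4] -/
def rcLaminar (a b : (Fin m → ℝ) → ℝ) {N : ℕ} (c : Fin N → (Fin m → ℝ) → ℝ) (k : ℕ)
    (x : Fin m → ℝ) : ℝ :=
  if hk : k < N + 2 then
    (fun i => rcFamily a b c i x) (Tuple.sort (fun i => rcFamily a b c i x) ⟨k, hk⟩)
  else b x

variable {N : ℕ} {c : Fin N → (Fin m → ℝ) → ℝ}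

/-- Values of the family lie in `[a x, b x]`. [cite: Pawlucki2024, Remark 2.2] -/
theorem rcFamily_mem_Icc (hab : a x ≤ b x) (i : Fin (N + 2)) : rcFamily a b c i x ∈ Icc (a x) (b x) := by
  refine Fin.cases ?_ (fun i => Fin.cases ?_ (fun i => ?_) i) i
  · simp [rcFamily, hab]
  · simp [rcFamily, hab]
  · simp only [rcFamily, Fin.cons_succ, rcClampFun]
    exact ⟨le_max_left _ _, max_le hab (min_le_right _ _)⟩

/-- `a x` is a value of the family. [cite: Pawlucki2024, Remark 2.2] -/
theorem rcFamily_zero : rcFamily a b c 0 x = a x := rfl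

/-- `b x` is a value of the family. [cite: Pawlucki2024, Remark 2.2] -/
theorem rcFamily_one : rcFamily a b c 1 x = b x := rfl

/-- The laminar functions are monotone in the index. [cite: Pawlucki2024, Remark 2.2] -/
theorem rcLaminar_mono (hab : a x ≤ b x) : Monotone fun k => rcLaminar a b c k x := by
  intro k l hkl
  unfold rcLaminar
  dsimp only
  by_cases hl : l < N + 2
  · have hk : k < N + 2 := lt_of_le_of_lt hkl hl
    rw [dif_pos hk, dif_pos hl]
    exact monotone_sort_apply (fun i => rcFamily a b c i x) (Fin.mk_le_mk.2 hkl)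
  · rw [dif_neg hl]
    by_cases hk : k < N + 2
    · rw [dif_pos hk]
      exact (rcFamily_mem_Icc hab _).2
    · rw [dif_neg hk]

/-- The lowest laminar function is `a`. [cite: Pawlucki2024, Remark 2.2] -/
theorem rcLaminar_zero (hab : a x ≤ b x) : rcLaminar a b c 0 x = a x := by
  unfold rcLaminar
  rw [dif_pos (Nat.zero_lt_succ _)]
  apply le_antisymm
  · -- at least one value (namely `a x`) is `≤ a x`
    refine sort_apply_le_of_card_le (fun i => rcFamily a b c i x) ⟨0, Nat.zero_lt_succ _⟩ (a x) ?_
    have h0 : (0 : Fin (N + 2)) ∈ Finset.univ.filter fun i : Fin (N + 2) => rcFamily a b c i x ≤ a x := by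
      rw [Finset.mem_filter]
      exact ⟨Finset.mem_univ _, le_of_eq rcFamily_zero⟩
    have h1 : 1 ≤ (Finset.univ.filter fun i : Fin (N + 2) => rcFamily a b c i x ≤ a x).card :=
      Finset.card_pos.2 ⟨0, h0⟩
    simpa using h1
  · -- all values are `≥ a x`
    obtain ⟨i, hi⟩ : ∃ i, (fun i => rcFamily a b c i x) (Tuple.sort (fun i => rcFamily a b c i x)
        ⟨0, Nat.zero_lt_succ _⟩) = rcFamily a b c i x := ⟨_, rfl⟩
    rw [hi]
    exact (rcFamily_mem_Icc hab i).1

/-- The highest laminar function (index `N + 1`) is `b`. [cite: Pawlucki2024, Remark 2.2] -/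
theorem rcLaminar_last (hab : a x ≤ b x) : rcLaminar a b c (N + 1) x = b x := by
  unfold rcLaminar
  rw [dif_pos (Nat.lt_succ_self _)]
  apply le_antisymm
  · obtain ⟨i, hi⟩ : ∃ i, (fun i => rcFamily a b c i x) (Tuple.sort (fun i => rcFamily a b c i x)
        ⟨N + 1, Nat.lt_succ_self _⟩) = rcFamily a b c i x := ⟨_, rfl⟩
    rw [hi]
    exact (rcFamily_mem_Icc hab i).2
  · refine le_sort_apply_of_card_le (fun i => rcFamily a b c i x) ⟨N + 1, Nat.lt_succ_self _⟩ (b x) ?_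
    -- at most `N + 1` values are `< b x` (the value at index `1` is `b x`)
    have h : (Finset.univ.filter fun i : Fin (N + 2) => rcFamily a b c i x < b x) ⊆
        Finset.univ.erase 1 := by
      intro i hi
      rw [Finset.mem_filter] at hi
      rw [Finset.mem_erase]
      refine ⟨fun h => ?_, Finset.mem_univ _⟩
      rw [h, rcFamily_one] at hi
      exact lt_irrefl _ hi.2
    calc (Finset.univ.filter fun i : Fin (N + 2) => rcFamily a b c i x < b x).card
        ≤ (Finset.univ.erase (1 : Fin (N + 2))).card := Finset.card_le_card h
      _ = N + 1 := by rw [Finset.card_erase_of_mem (Finset.mem_univ _)]; simp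

/-- Every laminar value is a value of the family (for indices in range). [cite: Pawlucki2024, Remark 2.2] -/
theorem exists_rcLaminar_eq {k : ℕ} (hk : k < N + 2) : ∃ i, rcLaminar a b c k x = rcFamily a b c i x := by
  unfold rcLaminar
  rw [dif_pos hk]
  exact ⟨_, rfl⟩

/-- Every value of the family is a laminar value. [cite: Pawlucki2024, Remark 2.2] -/
theorem exists_eq_rcLaminar (i : Fin (N + 2)) : ∃ k < N + 2, rcFamily a b c i x = rcLaminar a b c k x := by
  set σ := Tuple.sort (fun i => rcFamily a b c i x) with hσ
  refine ⟨(σ.symm i : ℕ), (σ.symm i).2, ?_⟩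
  unfold rcLaminar
  rw [dif_pos (σ.symm i).2]
  simp [hσ]

/-- No value of the family lies strictly between two consecutive laminar values.
[cite: Pawlucki2024, Remark 2.2] -/
theorem rcFamily_notMem_Ioo (hab : a x ≤ b x) (k : ℕ) (i : Fin (N + 2)) :
    rcFamily a b c i x ∉ Ioo (rcLaminar a b c k x) (rcLaminar a b c (k + 1) x) := by
  rintro ⟨h1, h2⟩
  obtain ⟨l, hl, hleq⟩ := exists_eq_rcLaminar (a := a) (b := b) (c := c) (x := x) i
  rw [hleq] at h1 h2
  have hmono := rcLaminar_mono (c := c) hab (x := x)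
  -- `k < l < k + 1` is impossible
  have hkl : k < l := by
    by_contra hle
    exact absurd (hmono (not_lt.1 hle)) (not_le.2 h1)
  have hlk : l < k + 1 := by
    by_contra hle
    exact absurd (hmono (not_lt.1 hle)) (not_le.2 h2)
  omega

open Classical in
/-- **The laminar refinement of a valid family is subordinate to the cover**: every nonempty open
piece `(α'_k x, α'_{k+1} x)` of the sorted family lies in a single `V j`.
[cite: Pawlucki2024, Prop. 2.5 with Remark 2.2 / Cor. 2.4] -/
theorem rcGood_rcLaminar (hab : a x ≤ b x) (hV : RCValid a b V (Finset.univ.image c) x) (k : ℕ)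
    (hk : rcLaminar a b c k x < rcLaminar a b c (k + 1) x) :
    RCGood V x (rcLaminar a b c k x) (rcLaminar a b c (k + 1) x) := by
  classical
  have hmono := rcLaminar_mono (c := c) hab (x := x)
  have hk1 : k + 1 < N + 2 := by
    by_contra hge
    have h1 : rcLaminar a b c (k + 1) x = b x := by
      unfold rcLaminar; rw [dif_neg hge]
    have h2 : b x ≤ rcLaminar a b c k x := by
      rw [← rcLaminar_last (c := c) hab]
      exact hmono (by omega)
    rw [h1] at hk
    exact absurd hk (not_lt.2 h2)
  have hlo : a x ≤ rcLaminar a b c k x := by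
    rw [← rcLaminar_zero (c := c) hab]; exact hmono (Nat.zero_le k)
  have hhi : rcLaminar a b c (k + 1) x ≤ b x := by
    rw [← rcLaminar_last (c := c) hab]; exact hmono (by omega)
  refine hV.rcGood hlo hhi hk fun w hw => ?_
  -- every cut value is a value of the family, hence not strictly inside
  have hwfam : ∃ i, w = rcFamily a b c i x := by
    rcases hw with rfl | rfl | ⟨c', hc', rfl, h1, h2⟩
    · exact ⟨0, rcFamily_zero.symm⟩
    · exact ⟨1, rcFamily_one.symm⟩
    · obtain ⟨i, -, rfl⟩ := Finset.mem_image.1 hc'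
      refine ⟨i.succ.succ, ?_⟩
      simp only [rcFamily, Fin.cons_succ, rcClampFun]
      rw [min_eq_left h2.le, max_eq_right h1.le]
  obtain ⟨i, rfl⟩ := hwfam
  have h := rcFamily_notMem_Ioo (c := c) hab k i (x := x)
  rw [Set.mem_Ioo, not_and_or, not_lt, not_lt] at h
  exact h

/-- **Continuity of the laminar refinement.** [cite: Pawlucki2024, Remark 2.2] -/
theorem continuousOn_rcLaminar {D : Set (Fin m → ℝ)} (ha : ContinuousOn a D) (hb : ContinuousOn b D)
    (hc : ∀ i, ContinuousOn (c i) D) (k : ℕ) : ContinuousOn (rcLaminar a b c k) D := by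
  unfold rcLaminar
  by_cases hk : k < N + 2
  · simp only [dif_pos hk]
    have hfam : ∀ i, ContinuousOn (rcFamily a b c i) D := by
      intro i
      refine Fin.cases ?_ (fun i => Fin.cases ?_ (fun i => ?_) i) i
      · exact ha
      · exact hb
      · simp only [rcFamily, Fin.cons_succ]
        unfold rcClampFun
        exact continuous_max.comp_continuousOn (ha.prodMk (continuous_min.comp_continuousOn
          ((hc i).prodMk hb)))
    -- continuity of order statistics on `D` via the restriction to the subtype
    have h := continuous_sort_apply (X := ↥D) (g := fun i (y : ↥D) => rcFamily a b c i (y : Fin m → ℝ))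
      (fun i => (hfam i).restrict) ⟨k, hk⟩
    rw [continuousOn_iff_continuous_restrict]
    exact h
  · simp only [dif_neg hk]
    exact hb

/-- **Semialgebraicity of the laminar refinement.** [cite: Pawlucki2024, Remark 2.2] -/
theorem isSemialgebraicFunOn_rcLaminar {D : Set (Fin m → ℝ)} (hD : IsSemialgebraic ℝ D)
    (ha : IsSemialgebraicFunOn ℝ D a) (hb : IsSemialgebraicFunOn ℝ D b)
    (hc : ∀ i, IsSemialgebraicFunOn ℝ D (c i)) (k : ℕ) : IsSemialgebraicFunOn ℝ D (rcLaminar a b c k) := by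
  unfold rcLaminar
  by_cases hk : k < N + 2
  · simp only [dif_pos hk]
    have hfam : ∀ i, IsSemialgebraicFunOn ℝ D (rcFamily a b c i) := by
      intro i
      refine Fin.cases ?_ (fun i => Fin.cases ?_ (fun i => ?_) i) i
      · exact ha
      · exact hb
      · simp only [rcFamily, Fin.cons_succ]
        unfold rcClampFun
        exact IsSemialgebraicFunOn.max hD ha (IsSemialgebraicFunOn.min hD (hc i) hb)
    exact IsSemialgebraicFunOn.sort_apply hD hfam ⟨k, hk⟩
  · simp only [dif_neg hk]
    exact hb

open Classical in
/-- **Summary (output of block B2 for block B5)**: from a cut family valid at every point of `D`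
one gets a continuous semialgebraic laminar family `α'_0 = a ≤ α'_1 ≤ ⋯ ≤ α'_{N+1} = b` on `D`
every nonempty open piece of which lies, fibrewise, in a single member of the cover.
[cite: Pawlucki2024, Prop. 2.5 with Cor. 2.4] -/
theorem exists_laminar_of_rcValid {D : Set (Fin m → ℝ)} (hD : IsSemialgebraic ℝ D)
    (ha : ContinuousOn a D) (hb : ContinuousOn b D) (has : IsSemialgebraicFunOn ℝ D a)
    (hbs : IsSemialgebraicFunOn ℝ D b) (hab : ∀ x ∈ D, a x ≤ b x)
    (hc : ∀ i, ContinuousOn (c i) D) (hcs : ∀ i, IsSemialgebraicFunOn ℝ D (c i))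
    (hV : ∀ x ∈ D, RCValid a b V (Finset.univ.image c) x) :
    ∃ (r : ℕ) (α : ℕ → (Fin m → ℝ) → ℝ),
      (∀ k, ContinuousOn (α k) D) ∧ (∀ k, IsSemialgebraicFunOn ℝ D (α k)) ∧
      (∀ x ∈ D, Monotone fun k => α k x) ∧ (∀ x ∈ D, α 0 x = a x) ∧ (∀ x ∈ D, ∀ k, r ≤ k → α k x = b x) ∧
      ∀ x ∈ D, ∀ k < r, α k x < α (k + 1) x → RCGood V x (α k x) (α (k + 1) x) := by
  refine ⟨N + 1, rcLaminar a b c, continuousOn_rcLaminar ha hb hc,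
    isSemialgebraicFunOn_rcLaminar hD has hbs hcs, fun x hx => rcLaminar_mono (hab x hx),
    fun x hx => rcLaminar_zero (hab x hx), fun x hx k hk => ?_, fun x hx k _ hlt =>
    rcGood_rcLaminar (hab x hx) (hV x hx) k hlt⟩
  rcases eq_or_lt_of_le hk with rfl | hlt
  · exact rcLaminar_last (hab x hx)
  · unfold rcLaminar
    rw [dif_neg (by omega)]

end RichCuts

end Literature.ModelTheory.ExponentialFields
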